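import Summits.HodgeConjecture.HodgeConjecture.Theorems.SignSymmetricPowersMeridianChart
import HarnessLib

/-!
# K1-B meridian package IV — pencil circles are meridians (route `SignSymmetricPowers`, item
# stmt-HodgeConjecture-19716)

Helper file (`--supports stmt-HodgeConjecture-19716`) for the open stubs GEN (`stub_signMeridianGeneration`) and
LINK (`stub_signConfluenceLinkG`) of the K1-B line `andre-zariski`: steps H5/H6 of memo K1B-GEN-STUBPLAN-g23 —
the dictionary between the route's loops `β · ω · β⁻¹` (a pencil circle `ω` of `S_M(ℂ)` around a nodal member
`f₁ + ε g`, `IsPencilCircle`, moved to the base point along `β`) and the `Meridian` structure of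
`FundamentalGroup/HypersurfaceComplementMeridians` on the arrangement complement
`affineHypersurfaceComplement h ≅ S_M(ℂ)` (package II, `SignSymmetricPowersMeridianChart`).

* `coeffChart_eq_discPoint` — the chart of a point with form `f₁ + c g` is the point `coeff_M f₁ + c · coeff_M g`
  of the straight disc.
* **`exists_meridian_of_pencilCircle`** — given the chart homeomorphism `e`, `M`-supported `f₁, g` with
  `coeff_M f₁` on exactly one factor `h_{j₀}` transversally to `coeff_M g` (package I,
  `SignSymmetricPowersMeridianOneNode.exists_unique_factor_pencil`), a radius `ε` with `f₁ + c g` nonsingular for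
  `0 < |c| ≤ ε` (F-PL's clause (i)), a path `β : t ⇝ s` with `F_s = f₁ + ε g` and a pencil circle `ω` at `s`:
  there is `μ : Meridian h (e t) j₀` with centre `coeff_M f₁`, direction `coeff_M g`, radius `ε`, whose loop
  class carried back to `S_M(ℂ)` (`FundamentalGroup.mapOfEq` along `e⁻¹`, into the subtype `Set.univ` on which
  the transports of `familyM` are indexed) IS the class of `β · ω · β⁻¹`.  With package III
  (`SignSymmetricPowersMeridianMonodromy.exists_conj_of_isConj` / `ratMonodromyGroup_eq_closure_conj`) the facts
  F-MC / F-ZvK about meridians become statements about the rational transports along the route's loops.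

Sorry-free; axioms standard; no definition, no named fact.

## References

* [Shimada2010ZvK] I. Shimada, Lectures on Zariski–van Kampen theorem (arXiv:0906.1074), §3 (leashed discs).
* [VoisinHodgeII2003] C. Voisin, Hodge Theory and Complex Algebraic Geometry II (CUP 2003), §3.2.1, §3.2.2, §6.2.1.
-/

noncomputable section

set_option linter.dupNamespace false

open MvPolynomial Topology unitInterval
open Literature.AlgebraicGeometry.Motives Literature.AlgebraicGeometry.Motives.UniversalHypersurface
open Literature.AlgebraicGeometry.HodgeTheory Literature.AlgebraicGeometry.HodgeTheory.UniversalHypersurface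
open Literature.AlgebraicGeometry.FundamentalGroup

namespace Summit.HodgeConjecture.HodgeConjecture.Theorems.SignSymmetricPowersMeridianPencil

variable (n d : ℕ) (M : Set (DegIndex n d)) [DecidablePred (· ∈ M)]

omit [DecidablePred (· ∈ M)] in
/-- The `M`-coefficient vector of a point of `S_M(ℂ)` is that of its form. [cite: VoisinHodgeII2003, §6.2.1] -/
theorem coeffChart_apply (t : ComplexPoints (baseM ℂ n d M)) (m : M) :
    ((coeffVector ℂ n d (AlgPoints.map (toBase ℂ n d M) t)) ∘ (Subtype.val : M → DegIndex n d)) m =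
      coeff m.1.1 (pointFormM ℂ n d M t) := by
  rw [Function.comp_apply, coeffVector_apply]

omit [DecidablePred (· ∈ M)] in
/-- The chart of a point whose form is `f₁ + c g` is the point `coeff_M f₁ + c · coeff_M g` of the straight disc
through `coeff_M f₁` in the direction `coeff_M g`. [cite: Shimada2010ZvK, §3 Definition before Prop. 3.4] -/
theorem coeffChart_eq_discPoint {f₁ g : MvPolynomial (Fin (n + 2)) ℂ} {c : ℂ} {t : ComplexPoints (baseM ℂ n d M)}
    (ht : pointFormM ℂ n d M t = f₁ + c • g) :
    (coeffVector ℂ n d (AlgPoints.map (toBase ℂ n d M) t)) ∘ (Subtype.val : M → DegIndex n d) =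
      discPoint (fun m : M => coeff m.1.1 f₁) (fun m : M => coeff m.1.1 g) c := by
  funext m
  rw [coeffChart_apply, ht, discPoint, coeff_add, coeff_smul, Pi.add_apply, Pi.smul_apply]

/-- **A pencil circle around a one-node centre, moved to the base point, is the loop of a meridian.**  Let
`e : S_M(ℂ) ≃ₜ affineHypersurfaceComplement h` be the coefficient chart onto the complement of the factors `hⱼ` of
the restricted discriminant (`SignSymmetricPowersMeridianChart.exists_homeomorph_affineHypersurfaceComplement`),
`f₁, g` `M`-supported forms with `a = coeff_M f₁` on exactly one factor `h_{j₀}`, transversally to `v = coeff_M g`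
(`SignSymmetricPowersMeridianOneNode.exists_unique_factor_pencil`), `ε > 0` with `f₁ + c g` nonsingular for
`0 < |c| ≤ ε`, `β` a path from the base point `t` to a point `s` with form `f₁ + ε g`, and `ω` a loop at `s` running
once around the pencil circle (`IsPencilCircle`).  Then there is a `Meridian h (e t) j₀` (centre `a`, direction
`v`, radius `ε`, leash `e ∘ β`) whose loop class, moved back to `S_M(ℂ)` along `e⁻¹`, is the class of
`β · ω · β⁻¹` — so the facts F-ZvK / F-MC about meridians speak about the transports along the pencil loops.
[cite: Shimada2010ZvK, §3 Definition before Prop. 3.4] [cite: VoisinHodgeII2003, §3.2.1 and §6.2.1] -/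
theorem exists_meridian_of_pencilCircle {m : ℕ} {h : Fin m → MvPolynomial M ℂ}
    (e : ComplexPoints (baseM ℂ n d M) ≃ₜ affineHypersurfaceComplement h)
    (he : ∀ t, ((e t : affineHypersurfaceComplement h) : M → ℂ) =
      (coeffVector ℂ n d (AlgPoints.map (toBase ℂ n d M) t)) ∘ (Subtype.val : M → DegIndex n d))
    {f₁ g : MvPolynomial (Fin (n + 2)) ℂ} (hf₁ : f₁.IsHomogeneous d) (hg : g.IsHomogeneous d)
    (hM₁ : IsSupportedOn n d M f₁) (hMg : IsSupportedOn n d M g) {j₀ : Fin m}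
    (hj₀ : MvPolynomial.eval (fun m' : M => coeff m'.1.1 f₁) (h j₀) = 0)
    (hj : ∀ i, i ≠ j₀ → MvPolynomial.eval (fun m' : M => coeff m'.1.1 f₁) (h i) ≠ 0)
    (htr : ∑ k, MvPolynomial.eval (fun m' : M => coeff m'.1.1 f₁) (pderiv k (h j₀)) * (fun m' : M => coeff m'.1.1 g) k ≠ 0)
    {ε : ℝ} (hε : 0 < ε) (hns : ∀ c : ℂ, c ≠ 0 → ‖c‖ ≤ ε → SmoothHypersurface.IsNonsingularForm ℂ (f₁ + c • g))
    {t s : ComplexPoints (baseM ℂ n d M)} (β : Path t s) (hs : pointFormM ℂ n d M s = f₁ + ((ε : ℝ) : ℂ) • g)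
    (ω : Path s s) (hω : IsPencilCircle n d f₁ g ε (ω.map (AlgPoints.mapContinuous (toBase ℂ n d M)).continuous)) :
    ∃ μ : Meridian h (e t) j₀, μ.y = (fun m' : M => coeff m'.1.1 f₁) ∧ μ.v = (fun m' : M => coeff m'.1.1 g) ∧ μ.ε = ε ∧
      FundamentalGroup.toPath (FundamentalGroup.mapOfEq
        (⟨fun z => ⟨e.symm z, Set.mem_univ _⟩, (continuous_id.subtype_mk _).comp e.symm.continuous⟩ :
          C(affineHypersurfaceComplement h, (Set.univ : Set (ComplexPoints (baseM ℂ n d M)))))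
        (show (⟨e.symm (e t), Set.mem_univ _⟩ : (Set.univ : Set (ComplexPoints (baseM ℂ n d M)))) =
          ⟨t, Set.mem_univ t⟩ from Subtype.ext (e.symm_apply_apply t)) μ.loopClass) =
      Path.Homotopic.Quotient.mk (((β.trans ω).trans β.symm).map
        (⟨fun s => ⟨s, Set.mem_univ s⟩, continuous_id.subtype_mk _⟩ :
          C(ComplexPoints (baseM ℂ n d M), (Set.univ : Set (ComplexPoints (baseM ℂ n d M))))).continuous) := by
  set a : M → ℂ := fun m' : M => coeff m'.1.1 f₁ with ha
  set v : M → ℂ := fun m' : M => coeff m'.1.1 g with hv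
  -- points of the punctured disc are charts of points of `S_M(ℂ)`
  have hdisc : ∀ c : ℂ, c ≠ 0 → ‖c‖ ≤ ε → discPoint a v c ∈ affineHypersurfaceComplement h := by
    intro c hc hcε
    have hhom : (f₁ + c • g).IsHomogeneous d := isHomogeneous_add_smul hf₁ hg c
    have hsupp : IsSupportedOn n d M (f₁ + c • g) := fun m' hm' => by
      rw [coeff_add, coeff_smul, hM₁ m' hm', hMg m' hm', smul_zero, add_zero]
    set t' := pointOfFormM ℂ n d M hhom (hns c hc hcε) hsupp with ht'
    have hform : pointFormM ℂ n d M t' = f₁ + c • g := pointFormM_pointOfFormM ℂ n d M hhom _ hsupp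
    rw [← coeffChart_eq_discPoint n d M hform, ← he t']
    exact (e t').2
  have hend : e s = ⟨discPoint a v (ε : ℂ), hdisc _ (by exact_mod_cast hε.ne') (by simp [abs_of_pos hε])⟩ :=
    Subtype.ext (by rw [he s]; exact coeffChart_eq_discPoint n d M hs)
  -- the meridian
  let μ : Meridian h (e t) j₀ :=
    { y := a, v := v, ε := ε, ε_pos := hε, eval_center := hj₀, eval_center_ne := hj, transversal := htr,
      discPoint_mem := hdisc,
      leashEnd_mem := hdisc _ (by exact_mod_cast hε.ne') (by simp [abs_of_pos hε]),
      leash := (β.map e.continuous).cast rfl hend.symm }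
  refine ⟨μ, rfl, rfl, rfl, ?_⟩
  -- the circle of `μ` is the chart image of `ω`
  have hcirc : μ.circle = (ω.map e.continuous).cast hend.symm hend.symm := by
    refine Path.ext (funext fun θ => Subtype.ext ?_)
    rw [Meridian.coe_circle_apply]
    change μ.circlePoint θ = ((e (ω θ) : affineHypersurfaceComplement h) : M → ℂ)
    rw [he (ω θ), coeffChart_eq_discPoint n d M (hω θ)]
    rfl
  -- hence its loop is the chart image of `β · ω · β⁻¹`
  have hloop : μ.loop = ((β.trans ω).trans β.symm).map e.continuous := by
    rw [Meridian.loop, hcirc, Path.map_trans, Path.map_trans, ← Path.map_symm]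
    exact Path.ext rfl
  rw [Meridian.loopClass_def, FundamentalGroup.mapOfEq_apply]
  change ((Path.Homotopic.Quotient.mk μ.loop).map _).cast _ _ = _
  rw [hloop, ← Path.Homotopic.Quotient.mk_map, ← Path.Homotopic.Quotient.mk_cast]
  congr 1
  refine Path.ext (funext fun θ => Subtype.ext ?_)
  change e.symm (e (((β.trans ω).trans β.symm) θ)) = ((β.trans ω).trans β.symm) θ
  exact e.symm_apply_apply _

end Summit.HodgeConjecture.HodgeConjecture.Theorems.SignSymmetricPowersMeridianPencil

end
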